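import Summits.ResolutionOfSingularities.ResolutionOfSingularities.Theorems.FrobeniusClosingSteerLowTowerFrameImage
import Summits.ResolutionOfSingularities.ResolutionOfSingularities.Theorems.FrobeniusClosingSteerLowTowerCritical
import Summits.ResolutionOfSingularities.ResolutionOfSingularities.Theorems.FrobeniusClosingSteerCriticalSurface
import Literature.AlgebraicGeometry.Resolution.RsopMonomialIdeals
import HarnessLib

/-!
# D3a part 6 (frame): the surface germ `A n = φ(R n)` at a threaded stage — clause (T1) from the threading invariant
(res-D-pv-012 AS res-L0-w41-stub-8; W4.1 crux `Steer`, LOW branch, strat-2 §σ2.24; consumes res-L0-w41-stub-3's `hinv` shape.) OURS; AI.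

* `exists_subalgebra_toSubring_eq_map` — the image `φ(R)` of a member containing `k` under a `k`-compatible map is (the underlying ring
  of) a `k`-subalgebra.
* `eq_two_of_add_two_eq_four` — `x + 2 = 4 → x = 2` in `WithBot ℕ∞` (Krull dimensions).
* `isRegularLocalRing_map_of_inv` — from stub-3's invariant at a stage (`𝔪_Λ ∩ R = (δ₁ f, δ₂ f)`, a part of a regular system of
  parameters of the `4`-dimensional `R`): `φ(R)` is a regular local ring of dimension `2`.
-/

noncomputable section
set_option linter.dupNamespace false

namespace Summit.ResolutionOfSingularities.ResolutionOfSingularities.Theorems.SwitchingDichotomy.LowTower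

open IsLocalRing
open Literature.AlgebraicGeometry.Resolution

variable {k K κ : Type} [Field k] [Field K] [Field κ] [Algebra k K] [Algebra k κ]

/-- The image `φ(R)` of a member `R ∋ k` under a `k`-compatible ring map is the underlying ring of a `k`-subalgebra. [folklore] -/
theorem exists_subalgebra_toSubring_eq_map (Λ : Subring K) (φ : Λ →+* κ) (hkΛ : ∀ c : k, algebraMap k K c ∈ Λ)
    (hφ : ∀ c : k, φ ⟨algebraMap k K c, hkΛ c⟩ = algebraMap k κ c) (R : Subring K) (hkR : ∀ c : k, algebraMap k K c ∈ R) :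
    ∃ A : Subalgebra k κ, A.toSubring = (R.comap Λ.subtype).map φ :=
  ⟨{ carrier := (R.comap Λ.subtype).map φ
     mul_mem' := fun ha hb => Subring.mul_mem _ ha hb
     one_mem' := Subring.one_mem _
     add_mem' := fun ha hb => Subring.add_mem _ ha hb
     zero_mem' := Subring.zero_mem _
     algebraMap_mem' := fun c => (mem_map_comap_iff Λ φ R _).mpr ⟨⟨algebraMap k K c, hkΛ c⟩, hkR c, hφ c⟩ },
    SetLike.ext (fun _ => Iff.rfl)⟩

/-- `x + 2 = 4 → x = 2` for Krull dimensions. [folklore] -/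
theorem eq_two_of_add_two_eq_four {x : WithBot ℕ∞} (h : x + 2 = (4 : ℕ)) : x = (2 : ℕ) := by
  induction x using WithBot.recBotCoe with
  | bot => simp at h
  | coe a =>
    induction a using ENat.recTopCoe with
    | top =>
      exfalso
      have h' : ((⊤ : ℕ∞) : WithBot ℕ∞) + 2 = ((4 : ℕ) : ℕ∞) := h
      rw [← WithBot.coe_ofNat, ← WithBot.coe_add, WithBot.coe_inj] at h'
      exact absurd h' (by simp)
    | coe n =>
      have h' : ((n : ℕ∞) : WithBot ℕ∞) + 2 = ((4 : ℕ) : ℕ∞) := h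
      rw [← WithBot.coe_ofNat, ← WithBot.coe_add, WithBot.coe_inj] at h'
      have h4 : n + 2 = 4 := by exact_mod_cast h'
      have hn : n = 2 := by omega
      subst hn; rfl

/-- **(T1) at a threaded stage**: if the trace of the non-units of `Λ` on the member `R ≤ Λ` is the ideal `(δ₁ f, δ₂ f)` of a Jacobian
pair which is part of a regular system of parameters of the `4`-dimensional `R` (res-L0-w41-stub-3's invariant), and `φ : Λ → κ` kills
exactly the non-units, then the surface germ `φ(R)` is a regular local ring of dimension `2`. [cite: Matsumura1987, Thm. 14.2] -/
theorem isRegularLocalRing_map_of_inv (Λ : Subring K) (φ : Λ →+* κ) (hker : ∀ r : Λ, φ r = 0 ↔ ¬ IsUnit r)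
    (R : Subring K) [IsLocalRing R] (hle : R ≤ Λ) (hdim : ringKrullDim R = (4 : ℕ)) (e₁ e₂ : R)
    (htrace : ∀ r : R, r ∈ Ideal.span {e₁, e₂} ↔ ¬ IsUnit (⟨(r : K), hle r.2⟩ : Λ)) (hrsop : IsRsopPart ![e₁, e₂]) :
    IsRegularLocalRing ((R.comap Λ.subtype).map φ) ∧ ringKrullDim ((R.comap Λ.subtype).map φ) = (2 : ℕ) := by
  have hsp : Ideal.span (Set.range ![e₁, e₂]) = Ideal.span {e₁, e₂} := CriticalSurface.span_range_pair e₁ e₂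
  haveI : IsRegularLocalRing (R ⧸ Ideal.span {e₁, e₂}) := hsp ▸ hrsop.isRegularLocalRing_quotient
  have hP : ∀ r : R, r ∈ Ideal.span {e₁, e₂} ↔ φ ⟨(r : K), hle r.2⟩ = 0 := fun r => by rw [htrace r, hker]
  obtain ⟨hreg, hd⟩ := isRegularLocalRing_map_of_quotient Λ φ R hle (Ideal.span {e₁, e₂}) hP
  refine ⟨hreg, ?_⟩
  rw [hd]
  have h := hrsop.ringKrullDim_quotient_add
  rw [hsp, hdim] at h
  exact eq_two_of_add_two_eq_four (by exact_mod_cast h)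

end Summit.ResolutionOfSingularities.ResolutionOfSingularities.Theorems.SwitchingDichotomy.LowTower

end
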